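/-
Chen 2024 (IACR ePrint 2024/555, version of 2024-04-18), Lemma 2.11 p. 12 / Lemma 2.15 p. 13 / Lemma 3.10
p. 23 / Lemma 3.20 p. 41 / Lemma 3.29 p. 56: the kernel verdicts on Step 8 (Lemma 3.13) and Step 9 (Lemma 3.8) are stated for the EXACT kets of
eq. (35) / eq. (40); Steps 1–7 only deliver states `≈_t`-close to them.  This module transports every verdict
that is a statement about Born PROBABILITIES across that approximation, with an explicit, dimension-free
modulus: relative `ℓ²` error `δ` in the state moves every outcome / event probability of every general
measurement by at most `4δ`.

REPRODUCTION / ANALYSIS OF A CLAIMED RESULT UNDER ADJUDICATION (withdrawn by its author, note of 2024-04-18).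
HONEST FRAMING: the VALUE is a THEOREM / DECIDABLE VERDICT / CERTIFICATE / precise negative result — NOT
summit progress.  Theorems about a WITHDRAWN algorithm; nothing is repaired, nothing is broken, no
cryptanalytic claim.  No named fact is introduced (debt 0).
-/
import Literature.Computability.Cryptography.ChenQuantumLWEStepNineInstrument

/-!
# Chen 2024, Steps 8–9: the verdicts are robust to the `≈_t` front end (Lemma 2.11)

Chen measures closeness of (unnormalised) states by Lemma 2.11 (p. 12): `‖ϕ − ψ‖ ≤ δ`, `‖ϕ‖ ≥ µ` gives trace
distance `O(√(δ/µ))` between the normalised states; Lemma 2.15 p. 13 (state preparation), Lemma 3.10 p. 23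
(Step 1), Lemma 3.20 p. 41 and Lemma 3.29 p. 56 (the `≈_t` bookkeeping of Steps 2–7) are of this form, so what reaches Step 8 is
a ket `ψ` with `‖ψ − φ7‖ ≤ δ‖φ7‖` (resp. `‖ψ − φ8.f‖ ≤ δ‖φ8.f‖` at eq. (40)), `δ = 2^{-Ω(n)}`, not the displayed
ket itself.  The modules `ChenQuantumLWEStepNineVerdict` / `…PlantedSlots` / `…StepNineInstrument` (Step 9)
and `ChenQuantumLWERobustMeasurement` / `…StepEightFinal` (Step 8) decide the displayed kets.  Here:

1. `POVM.prob`, **`POVM.abs_prob_sub_prob_le`** — for ANY general measurement `E` (POVM, any outcome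
   alphabet) and any two kets with `⟨ψ−φ|ψ−φ⟩ ≤ δ²⟨φ|φ⟩` (`δ ≥ 0`, no other hypothesis; `0/0 = 0`):
   `|Pr_ψ[k] − Pr_φ[k]| ≤ 4δ` for every outcome `k`; `POVM.AlmostCertain.of_close` — an `ε`-almost-certain
   outcome on `ψ` is `(ε + 4δ)`-almost certain on `φ`.  (Linear in `δ`; Lemma 2.11 prints `O(√δ)`.)
2. `basisPOVM`, `basisProb`, **`abs_basisProb_sub_le`** — the same for every EVENT `V` of a computational-
   basis measurement: `|Pr_x[u ∈ V] − Pr_y[u ∈ V]| ≤ 4δ` when `Σ‖x−y‖² ≤ δ² Σ‖y‖²`.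
3. Step 9 (**`Shape.born_event_robust`**, **`Shape.probEq41_robust`**, `…_planted`,
   `Shape.born_event_robust_instance_indep`): for every ISOMETRIC processing `K` of coordinate 1 (every
   coherent replacement of (9.e)–(9.g), and `K = 1`), every event `V` of the final measurement after
   `QFT_{ℤ_N^{n+1}}`, and every input `ψ` with `‖ψ − φ8.f‖ ≤ δ‖φ8.f‖`: the probability of `V` is within `4δ`
   of its (instance-independent) value on `|φ8.f⟩`; in particular **`Pr_ψ[(41)] ≤ 1/Q + 4δ`** — Lemma 3.8
   claimed `1 − negl(n)`; with `Q ≥ 3` and `δ = negl(n)` the bound is `≤ 1/3 + negl(n)`.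
4. Step 8 (**`Shape.fifthOp_readout_robust`**, **`Shape.step9Needs_not_almostSurely_measurable_robust`**):
   on any `χ` with `‖χ − φ7.d‖ ≤ δ‖φ7.d‖` the fifth operation still reads `v′₀/D mod Dp₁` with probability
   `≥ 1 − 4δ` (the positive half of Lemma 3.13 survives), and NO general measurement reads the Step-9 datum
   `v′₀ mod D²P` `ε`-almost surely off ANY family of actual states `δ`-close to the `|φ7.d⟩` of their
   instances once `4(ε + 4δ)P² < 1` (the negative half survives: the obstruction is not an artefact of
   idealising the state).
So the failure located by the author's note (p. 37) is decided for the algorithm AS SPECIFIED, approximate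
front end included: the exponentially small state-preparation / `≈_t` errors move no verdict.
[cite: ChenQuantumLattice2024, Lemma 2.11 p. 12, Lemma 2.15 p. 13, Lemma 3.10 p. 23, Lemma 3.20 p. 41,
Lemma 3.29 p. 56, §3.5.8 pp. 32–34, §3.5.9 pp. 34–38, eq. (41) p. 38; NielsenChuang2010, §2.2.3 p. 84,
§2.2.6 p. 90, §9.2.1 pp. 403–406, eq. (9.22) p. 404]
-/

namespace Literature.Computability.Cryptography.Chen2024

open scoped BigOperators ComplexOrder MatrixOrder
open Matrix WithLp Finset

/-! ### 1. Norms of amplitude vectors -/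

section Norms

variable {X : Type*} [Fintype X]

/-- `⟨ψ|ψ⟩ = Σ_x |ψ_x|²` (real part). [folklore] -/
theorem star_dotProduct_self_re_eq_sum (ψ : X → ℂ) : (star ψ ⬝ᵥ ψ).re = ∑ x, ‖ψ x‖ ^ 2 := by
  simp only [dotProduct, Pi.star_apply, Complex.star_def, Complex.conj_mul', Complex.re_sum]
  refine Finset.sum_congr rfl fun x _ => ?_
  norm_cast

/-- `⟨ψ|ψ⟩ = ‖ψ‖²` for the `ℓ²` norm (`EuclideanSpace ℂ X`). [folklore] -/
theorem star_dotProduct_self_re_eq_norm_sq (ψ : X → ℂ) :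
    (star ψ ⬝ᵥ ψ).re = ‖(toLp 2 ψ : EuclideanSpace ℂ X)‖ ^ 2 := by
  rw [EuclideanSpace.norm_sq_eq, star_dotProduct_self_re_eq_sum]

/-- `‖ψ‖² = Σ_x |ψ_x|²` for the `ℓ²` norm. [folklore] -/
theorem norm_toLp_sq_eq_sum (ψ : X → ℂ) : ‖(toLp 2 ψ : EuclideanSpace ℂ X)‖ ^ 2 = ∑ x, ‖ψ x‖ ^ 2 :=
  EuclideanSpace.norm_sq_eq _

/-- From `⟨ψ−φ|ψ−φ⟩ ≤ δ²⟨φ|φ⟩` to `‖ψ − φ‖ ≤ δ‖φ‖`. [folklore] -/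
theorem norm_sub_le_of_dotProduct_le {ψ φ : X → ℂ} {δ : ℝ} (hδ : 0 ≤ δ)
    (hclose : (star (ψ - φ) ⬝ᵥ (ψ - φ)).re ≤ δ ^ 2 * (star φ ⬝ᵥ φ).re) :
    ‖(toLp 2 ψ : EuclideanSpace ℂ X) - toLp 2 φ‖ ≤ δ * ‖(toLp 2 φ : EuclideanSpace ℂ X)‖ := by
  rw [star_dotProduct_self_re_eq_norm_sq, star_dotProduct_self_re_eq_norm_sq, ← mul_pow,
    WithLp.toLp_sub] at hclose
  exact (pow_le_pow_iff_left₀ (norm_nonneg _) (by positivity) two_ne_zero).1 hclose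

/-- Closeness in the `Σ|·|²` currency of the Chen modules is closeness in the `⟨·|·⟩` currency. [folklore] -/
theorem dotProduct_close_of_sum_close {ψ φ : X → ℂ} {δ : ℝ}
    (h : ∑ x, ‖ψ x - φ x‖ ^ 2 ≤ δ ^ 2 * ∑ x, ‖φ x‖ ^ 2) :
    (star (ψ - φ) ⬝ᵥ (ψ - φ)).re ≤ δ ^ 2 * (star φ ⬝ᵥ φ).re := by
  rw [star_dotProduct_self_re_eq_sum, star_dotProduct_self_re_eq_sum]
  simpa only [Pi.sub_apply] using h

end Norms

/-! ### 2. Born probabilities of a general measurement are `4δ`-Lipschitz in the relative state error -/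

namespace POVM

variable {X κ : Type*} [Fintype X] [DecidableEq X] [Fintype κ] [DecidableEq κ] (E : POVM X κ)

/-- `|⟨ψ|E_k|χ⟩| ≤ ‖ψ‖·‖χ‖` for an effect `0 ≤ E_k ≤ 1`. [cite: NielsenChuang2010, §2.2.6 p. 90][folklore] -/
theorem norm_dotProduct_effect_mulVec_le (k : κ) (ψ χ : X → ℂ) :
    ‖star ψ ⬝ᵥ (E.effect k *ᵥ χ)‖
      ≤ ‖(toLp 2 ψ : EuclideanSpace ℂ X)‖ * ‖(toLp 2 χ : EuclideanSpace ℂ X)‖ := by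
  have h1 := norm_sq_dotProduct_mulVec_le (E.posSemidef k) ψ χ
  have h2 : (star ψ ⬝ᵥ (E.effect k *ᵥ ψ)).re ≤ ‖(toLp 2 ψ : EuclideanSpace ℂ X)‖ ^ 2 := by
    rw [← star_dotProduct_self_re_eq_norm_sq]; exact E.weight_re_le ψ k
  have h3 : (star χ ⬝ᵥ (E.effect k *ᵥ χ)).re ≤ ‖(toLp 2 χ : EuclideanSpace ℂ X)‖ ^ 2 := by
    rw [← star_dotProduct_self_re_eq_norm_sq]; exact E.weight_re_le χ k
  have h0 : 0 ≤ (star χ ⬝ᵥ (E.effect k *ᵥ χ)).re := E.weight_re_nonneg χ k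
  have h4 : ‖star ψ ⬝ᵥ (E.effect k *ᵥ χ)‖ ^ 2
      ≤ (‖(toLp 2 ψ : EuclideanSpace ℂ X)‖ * ‖(toLp 2 χ : EuclideanSpace ℂ X)‖) ^ 2 := by
    rw [mul_pow]
    exact h1.trans (mul_le_mul h2 h3 h0 (by positivity))
  exact (pow_le_pow_iff_left₀ (norm_nonneg _) (by positivity) two_ne_zero).1 h4

/-- **Born weights are Lipschitz:** `|⟨ψ|E_k|ψ⟩ − ⟨φ|E_k|φ⟩| ≤ ‖ψ − φ‖ (‖ψ‖ + ‖φ‖)`.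
[cite: NielsenChuang2010, §2.2.6 p. 90, §9.2.1 eq. (9.22) p. 404][folklore] -/
theorem abs_weight_re_sub_le (k : κ) (ψ φ : X → ℂ) :
    |(E.weight ψ k).re - (E.weight φ k).re|
      ≤ ‖(toLp 2 ψ : EuclideanSpace ℂ X) - toLp 2 φ‖
          * (‖(toLp 2 ψ : EuclideanSpace ℂ X)‖ + ‖(toLp 2 φ : EuclideanSpace ℂ X)‖) := by
  have hsplit : E.weight ψ k - E.weight φ k
      = star ψ ⬝ᵥ (E.effect k *ᵥ (ψ - φ)) + star (ψ - φ) ⬝ᵥ (E.effect k *ᵥ φ) := by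
    simp only [POVM.weight, Matrix.mulVec_sub, dotProduct_sub, star_sub, sub_dotProduct]
    ring
  have ha := E.norm_dotProduct_effect_mulVec_le k ψ (ψ - φ)
  have hb := E.norm_dotProduct_effect_mulVec_le k (ψ - φ) φ
  rw [WithLp.toLp_sub] at ha hb
  rw [← Complex.sub_re, hsplit, Complex.add_re]
  calc |(star ψ ⬝ᵥ (E.effect k *ᵥ (ψ - φ))).re + (star (ψ - φ) ⬝ᵥ (E.effect k *ᵥ φ)).re|
      ≤ |(star ψ ⬝ᵥ (E.effect k *ᵥ (ψ - φ))).re| + |(star (ψ - φ) ⬝ᵥ (E.effect k *ᵥ φ)).re| :=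
        abs_add_le _ _
    _ ≤ ‖star ψ ⬝ᵥ (E.effect k *ᵥ (ψ - φ))‖ + ‖star (ψ - φ) ⬝ᵥ (E.effect k *ᵥ φ)‖ :=
        add_le_add (Complex.abs_re_le_norm _) (Complex.abs_re_le_norm _)
    _ ≤ ‖(toLp 2 ψ : EuclideanSpace ℂ X)‖ * ‖(toLp 2 ψ : EuclideanSpace ℂ X) - toLp 2 φ‖
          + ‖(toLp 2 ψ : EuclideanSpace ℂ X) - toLp 2 φ‖ * ‖(toLp 2 φ : EuclideanSpace ℂ X)‖ :=
        add_le_add ha hb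
    _ = _ := by ring

/-- The Born PROBABILITY of outcome `k` on the (unnormalised) ket `ψ`: `⟨ψ|E_k|ψ⟩ / ⟨ψ|ψ⟩` (`0/0 = 0`).
[cite: NielsenChuang2010, §2.2.6 p. 90] -/
noncomputable def prob (ψ : X → ℂ) (k : κ) : ℝ := (E.weight ψ k).re / (star ψ ⬝ᵥ ψ).re

omit [DecidableEq κ] in
/-- `0 ≤ Pr_ψ[k]`. [cite: NielsenChuang2010, §2.2.6 p. 90] -/
theorem prob_nonneg (ψ : X → ℂ) (k : κ) : 0 ≤ E.prob ψ k :=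
  div_nonneg (E.weight_re_nonneg ψ k) (star_dotProduct_self_re_nonneg ψ)

/-- `Pr_ψ[k] ≤ 1`. [cite: NielsenChuang2010, §2.2.6 p. 90] -/
theorem prob_le_one (ψ : X → ℂ) (k : κ) : E.prob ψ k ≤ 1 :=
  div_le_one_of_le₀ (E.weight_re_le ψ k) (star_dotProduct_self_re_nonneg ψ)

omit [DecidableEq κ] in
/-- `Σ_k Pr_ψ[k] = 1` for `ψ ≠ 0`. [cite: NielsenChuang2010, §2.2.6 p. 90] -/
theorem sum_prob {ψ : X → ℂ} (hψ : ψ ≠ 0) : ∑ k, E.prob ψ k = 1 := by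
  unfold prob
  rw [← Finset.sum_div, E.sum_weight_re ψ, div_self (star_dotProduct_self_re_pos hψ).ne']

omit [DecidableEq κ] in
/-- Weights scale quadratically: `⟨cψ|E_k|cψ⟩ = |c|²⟨ψ|E_k|ψ⟩`. [cite: NielsenChuang2010, §2.2.6 p. 90] -/
theorem weight_smul (c : ℂ) (ψ : X → ℂ) (k : κ) :
    E.weight (c • ψ) k = (starRingEnd ℂ c * c) * E.weight ψ k := by
  simp only [POVM.weight, star_smul, Matrix.mulVec_smul, smul_dotProduct, dotProduct_smul, smul_eq_mul,
    Complex.star_def]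
  ring

omit [DecidableEq κ] in
/-- **Probabilities see only the ray:** `Pr_{cψ}[k] = Pr_ψ[k]` for `c ≠ 0`. [cite: NielsenChuang2010, §2.2.7 p. 93] -/
theorem prob_smul {c : ℂ} (hc : c ≠ 0) (ψ : X → ℂ) (k : κ) : E.prob (c • ψ) k = E.prob ψ k := by
  unfold prob
  have h2 : star (c • ψ) ⬝ᵥ (c • ψ) = (starRingEnd ℂ c * c) * (star ψ ⬝ᵥ ψ) := by
    simp only [star_smul, smul_dotProduct, dotProduct_smul, smul_eq_mul, Complex.star_def]
    ring
  rw [E.weight_smul, h2, Complex.conj_mul', ← Complex.ofReal_pow, Complex.re_ofReal_mul,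
    Complex.re_ofReal_mul]
  exact mul_div_mul_left _ _ (by positivity)

omit [DecidableEq κ] in
/-- `ε`-almost certainty is `Pr_ψ[k] ≥ 1 − ε` (for `ψ ≠ 0`). [cite: NielsenChuang2010, §2.2.6 p. 90] -/
theorem almostCertain_iff_le_prob {ε : ℝ} {ψ : X → ℂ} (hψ : ψ ≠ 0) {k : κ} :
    E.AlmostCertain ε ψ k ↔ 1 - ε ≤ E.prob ψ k := by
  unfold AlmostCertain prob
  rw [le_div_iff₀ (star_dotProduct_self_re_pos hψ)]

/-- **Born probabilities are `4δ`-Lipschitz in the relative state error** (the quantitative Lemma 2.11):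
for every POVM `E`, outcome `k`, and kets `ψ, φ` with `⟨ψ−φ|ψ−φ⟩ ≤ δ²⟨φ|φ⟩` (`δ ≥ 0`):
`|Pr_ψ[k] − Pr_φ[k]| ≤ 4δ`.  Proof: probabilities see only the ray, so rescale `ψ` to `ψ′` with
`‖ψ′‖ = ‖φ‖`; then `‖ψ′ − φ‖ ≤ 2‖ψ − φ‖` and `|⟨ψ′|E|ψ′⟩ − ⟨φ|E|φ⟩| ≤ ‖ψ′−φ‖·2‖φ‖`.  Degenerate cases
(`φ = 0`, `ψ = 0`, `δ ≥ 1`) hold by `0/0 = 0` and `Pr ∈ [0,1]`.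
[cite: ChenQuantumLattice2024, Lemma 2.11 p. 12; NielsenChuang2010, §9.2.1 pp. 403–406, eq. (9.22) p. 404][folklore] -/
theorem abs_prob_sub_prob_le (k : κ) {ψ φ : X → ℂ} {δ : ℝ} (hδ : 0 ≤ δ)
    (hclose : (star (ψ - φ) ⬝ᵥ (ψ - φ)).re ≤ δ ^ 2 * (star φ ⬝ᵥ φ).re) :
    |E.prob ψ k - E.prob φ k| ≤ 4 * δ := by
  have hd := norm_sub_le_of_dotProduct_le hδ hclose
  set x : EuclideanSpace ℂ X := toLp 2 ψ with hx
  set y : EuclideanSpace ℂ X := toLp 2 φ with hy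
  have hp0 := E.prob_nonneg ψ k
  have hp1 := E.prob_le_one ψ k
  have hq0 := E.prob_nonneg φ k
  have hq1 := E.prob_le_one φ k
  -- `φ`-norm zero: then `ψ = φ`.
  rcases (norm_nonneg y).eq_or_lt with hy0 | hypos
  · have hxy : ‖x - y‖ = 0 := le_antisymm (by rw [← hy0, mul_zero] at hd; exact hd) (norm_nonneg _)
    have hψφ : ψ = φ := by
      by_contra hne
      have hpos := star_dotProduct_self_re_pos (sub_ne_zero.2 hne)
      rw [star_dotProduct_self_re_eq_norm_sq, WithLp.toLp_sub, ← hx, ← hy, hxy] at hpos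
      simp at hpos
    subst hψφ
    simp only [sub_self, abs_zero]
    positivity
  -- `ψ = 0`: then `δ ≥ 1`.
  by_cases hψ : ψ = 0
  · have hx0 : x = 0 := by rw [hx, hψ, WithLp.toLp_zero]
    rw [hx0, zero_sub, norm_neg] at hd
    have hδ1 : 1 ≤ δ := le_of_mul_le_mul_right (by simpa using hd) hypos
    have hψ0 : E.prob ψ k = 0 := by simp [prob, hψ, POVM.weight]
    rw [hψ0, zero_sub, abs_neg, abs_of_nonneg hq0]
    linarith
  -- main case: rescale `ψ` to the norm of `φ`.
  have hxne : ‖x‖ ≠ 0 := by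
    intro h0
    have hpos := star_dotProduct_self_re_pos hψ
    rw [star_dotProduct_self_re_eq_norm_sq, ← hx, h0] at hpos
    simp at hpos
  have hxpos : 0 < ‖x‖ := lt_of_le_of_ne (norm_nonneg _) (Ne.symm hxne)
  set r : ℝ := ‖y‖ / ‖x‖ with hr
  have hrpos : 0 < r := div_pos hypos hxpos
  have hc : (r : ℂ) ≠ 0 := Complex.ofReal_ne_zero.2 hrpos.ne'
  rw [← E.prob_smul hc ψ k]
  set x' : EuclideanSpace ℂ X := toLp 2 ((r : ℂ) • ψ) with hx'
  have hx'eq : x' = (r : ℂ) • x := by rw [hx', WithLp.toLp_smul]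
  have hnx' : ‖x'‖ = ‖y‖ := by
    rw [hx'eq, norm_smul, Complex.norm_real, Real.norm_eq_abs, abs_of_pos hrpos, hr,
      div_mul_cancel₀ _ hxne]
  have hx'x : ‖x' - x‖ ≤ ‖x - y‖ := by
    have e1 : x' - x = (((r - 1 : ℝ)) : ℂ) • x := by
      rw [hx'eq, Complex.ofReal_sub, Complex.ofReal_one, sub_smul, one_smul]
    have e2 : |r - 1| * ‖x‖ = |‖y‖ - ‖x‖| := by
      rw [← abs_of_pos hxpos, ← abs_mul, abs_of_pos hxpos, sub_mul, hr, div_mul_cancel₀ _ hxne, one_mul]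
    rw [e1, norm_smul, Complex.norm_real, Real.norm_eq_abs, e2, norm_sub_rev x y]
    exact abs_norm_sub_norm_le y x
  have hx'y : ‖x' - y‖ ≤ 2 * (δ * ‖y‖) :=
    calc ‖x' - y‖ ≤ ‖x' - x‖ + ‖x - y‖ := norm_sub_le_norm_sub_add_norm_sub _ _ _
      _ ≤ ‖x - y‖ + ‖x - y‖ := by linarith [hx'x]
      _ ≤ 2 * (δ * ‖y‖) := by linarith [hd]
  have hA := E.abs_weight_re_sub_le k ((r : ℂ) • ψ) φ
  rw [← hx', ← hy, hnx'] at hA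
  have hden1 : (star ((r : ℂ) • ψ) ⬝ᵥ ((r : ℂ) • ψ)).re = ‖y‖ ^ 2 := by
    rw [star_dotProduct_self_re_eq_norm_sq, ← hx', hnx']
  have hden2 : (star φ ⬝ᵥ φ).re = ‖y‖ ^ 2 := by
    rw [star_dotProduct_self_re_eq_norm_sq]
  have hy2 : (0 : ℝ) < ‖y‖ ^ 2 := by positivity
  unfold prob
  rw [hden1, hden2, ← sub_div, abs_div, abs_of_pos hy2, div_le_iff₀ hy2]
  calc |(E.weight ((r : ℂ) • ψ) k).re - (E.weight φ k).re|
      ≤ ‖x' - y‖ * (‖y‖ + ‖y‖) := hA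
    _ ≤ 2 * (δ * ‖y‖) * (‖y‖ + ‖y‖) := mul_le_mul_of_nonneg_right hx'y (by positivity)
    _ = 4 * δ * ‖y‖ ^ 2 := by ring

/-- **Almost-certainty transfers across the approximation:** if outcome `k` is `ε`-almost certain on `ψ`
(`ε ≥ 0`) and `⟨ψ−φ|ψ−φ⟩ ≤ δ²⟨φ|φ⟩` (`δ ≥ 0`), then `k` is `(ε + 4δ)`-almost certain on `φ`.
[cite: ChenQuantumLattice2024, Lemma 2.11 p. 12; NielsenChuang2010, §2.2.6 p. 90][folklore] -/
theorem AlmostCertain.of_close {E : POVM X κ} {ε δ : ℝ} {ψ φ : X → ℂ} {k : κ}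
    (h : E.AlmostCertain ε ψ k) (hε : 0 ≤ ε) (hδ : 0 ≤ δ)
    (hclose : (star (ψ - φ) ⬝ᵥ (ψ - φ)).re ≤ δ ^ 2 * (star φ ⬝ᵥ φ).re) :
    E.AlmostCertain (ε + 4 * δ) φ k := by
  by_cases hφ : φ = 0
  · subst hφ
    simp [AlmostCertain, POVM.weight]
  by_cases hψ : ψ = 0
  · subst hψ
    have ha := star_dotProduct_self_re_pos hφ
    have h1 : (star ((0 : X → ℂ) - φ) ⬝ᵥ ((0 : X → ℂ) - φ)).re = (star φ ⬝ᵥ φ).re := by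
      rw [zero_sub, star_neg, neg_dotProduct, dotProduct_neg, neg_neg]
    rw [h1] at hclose
    have hδ2 : 1 ≤ δ ^ 2 := le_of_mul_le_mul_right (by rw [one_mul]; exact hclose) ha
    have hδ1 : 1 ≤ δ := by nlinarith [hδ2, hδ]
    unfold AlmostCertain
    have hneg : (1 - (ε + 4 * δ)) * (star φ ⬝ᵥ φ).re ≤ 0 :=
      mul_nonpos_of_nonpos_of_nonneg (by linarith) ha.le
    exact hneg.trans (E.weight_re_nonneg φ k)
  · have h1 := (E.almostCertain_iff_le_prob hψ).1 h
    have h2 := (abs_sub_le_iff.1 (E.abs_prob_sub_prob_le k hδ hclose)).1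
    rw [E.almostCertain_iff_le_prob hφ]
    linarith

end POVM

/-! ### 3. Computational-basis measurements: events -/

section Basis

variable (X : Type*) [Fintype X] [DecidableEq X]

/-- The complete projective measurement in the computational basis, `E_u = |u⟩⟨u|`.
[cite: NielsenChuang2010, §2.2.3 p. 84, §2.2.5 p. 87] -/
noncomputable def basisPOVM : POVM X X where
  effect u := Matrix.diagonal (Pi.single u 1)
  posSemidef u := Matrix.PosSemidef.diagonal fun x => by
    by_cases hx : x = u
    · subst hx
      simp
    · simp [Pi.single_eq_of_ne hx]
  sum_eq_one := by
    ext i j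
    simp only [Matrix.sum_apply, Matrix.diagonal_apply, Pi.single_apply, Matrix.one_apply]
    by_cases hij : i = j
    · simp [hij]
    · simp [hij]

variable {X}

/-- The Born weight of outcome `u` in the basis measurement is `|χ_u|²`. [cite: NielsenChuang2010, §2.2.3 p. 84] -/
theorem basisPOVM_weight (χ : X → ℂ) (u : X) : (basisPOVM X).weight χ u = (((‖χ u‖ ^ 2 : ℝ)) : ℂ) := by
  simp only [POVM.weight, basisPOVM, Matrix.mulVec_diagonal, dotProduct, Pi.star_apply, Pi.single_apply]
  rw [Finset.sum_eq_single u]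
  · simp [Complex.conj_mul']
  · intro x _ hx
    simp [hx]
  · intro hu
    exact absurd (Finset.mem_univ u) hu

/-- `Pr_χ[u ∈ V]` for the basis measurement of the (unnormalised) ket `χ` (ratio form, `0/0 = 0`) — the
currency of `Shape.probEq41`, `Shape.probHeadDvd`, `Shape.fifthOp_weight`.
[cite: NielsenChuang2010, §2.2.3 p. 84] -/
noncomputable def basisProb (V : Finset X) (χ : X → ℂ) : ℝ := (∑ u ∈ V, ‖χ u‖ ^ 2) / ∑ u, ‖χ u‖ ^ 2

/-- An event of the basis measurement is the outcome `true` of the coarse-grained POVM.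
[cite: NielsenChuang2010, §2.2.3 p. 84, §2.2.6 p. 90] -/
theorem basisProb_eq_prob (V : Finset X) (χ : X → ℂ) :
    basisProb V χ = ((basisPOVM X).relabel fun u => decide (u ∈ V)).prob χ true := by
  unfold basisProb POVM.prob
  rw [POVM.relabel_weight, Complex.re_sum, star_dotProduct_self_re_eq_sum]
  have hV : (Finset.univ.filter fun u => decide (u ∈ V) = true) = V := by
    ext u
    simp
  rw [hV]
  congr 1
  refine Finset.sum_congr rfl fun u _ => ?_
  rw [basisPOVM_weight, Complex.ofReal_re]

omit [DecidableEq X] in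
/-- `0 ≤ Pr_χ[V]`. [cite: NielsenChuang2010, §2.2.3 p. 84] -/
theorem basisProb_nonneg (V : Finset X) (χ : X → ℂ) : 0 ≤ basisProb V χ := by
  unfold basisProb; positivity

omit [DecidableEq X] in
/-- `Pr_χ[V] ≤ 1`. [cite: NielsenChuang2010, §2.2.3 p. 84] -/
theorem basisProb_le_one (V : Finset X) (χ : X → ℂ) : basisProb V χ ≤ 1 :=
  div_le_one_of_le₀ (Finset.sum_le_sum_of_subset_of_nonneg (Finset.subset_univ V)
    fun u _ _ => sq_nonneg ‖χ u‖) (Finset.sum_nonneg fun u _ => sq_nonneg ‖χ u‖)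

/-- **Event probabilities are `4δ`-Lipschitz in the relative state error:** for every event `V` and kets
`x, y` with `Σ|x−y|² ≤ δ² Σ|y|²` (`δ ≥ 0`): `|Pr_x[V] − Pr_y[V]| ≤ 4δ`.
[cite: ChenQuantumLattice2024, Lemma 2.11 p. 12; NielsenChuang2010, §9.2.1 pp. 403–406, eq. (9.22) p. 404][folklore] -/
theorem abs_basisProb_sub_le (V : Finset X) (x y : X → ℂ) {δ : ℝ} (hδ : 0 ≤ δ)
    (hclose : ∑ u, ‖x u - y u‖ ^ 2 ≤ δ ^ 2 * ∑ u, ‖y u‖ ^ 2) :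
    |basisProb V x - basisProb V y| ≤ 4 * δ := by
  rw [basisProb_eq_prob, basisProb_eq_prob]
  exact POVM.abs_prob_sub_prob_le _ true hδ (dotProduct_close_of_sum_close hclose)

end Basis

/-! ### 4. Linearity of the `QFT` -/

/-- `QFT` is additive: `QFT(ψ − φ) = QFT ψ − QFT φ`. [cite: ChenQuantumLattice2024, Lemma 2.12 p. 12] -/
theorem qft_sub {n m : ℕ} [NeZero m] (ψ φ : Ket n m) : qft (ψ - φ) = qft ψ - qft φ := by
  funext u
  simp only [qft, Pi.sub_apply, sub_mul, Finset.sum_sub_distrib]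

namespace Shape

variable (S : Shape)

/-! ### 5. Step 9 on an approximate input -/

/-- Coordinate-1 processing by the kernel `K` of an ARBITRARY input ket (Chen's (9.e)–(9.g) applied to what
Steps 1–8 actually deliver): `(processedOf K ψ)(z) = Σ_y K (z 0) y · ψ(y, z[1..n])`; `processedOf K φ8f =
processed K`. [cite: ChenQuantumLattice2024, §3.5.9 (9.e)–(9.g) pp. 37–38] -/
noncomputable def processedOf (K : ZMod S.N → ZMod S.N → ℂ) (ψ : Ket (S.n + 1) S.N) : Ket (S.n + 1) S.N :=
  fun z => ∑ y : ZMod S.N, K (z 0) y * ψ (Fin.cons y (Fin.tail z))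

/-- On the displayed ket: `processedOf K |φ8.f⟩ = processed K`. [cite: ChenQuantumLattice2024, eq. (40) p. 36] -/
theorem processedOf_phi8f (K : ZMod S.N → ZMod S.N → ℂ) : S.processedOf K S.phi8f = S.processed K := rfl

/-- The processing is linear in the input. [cite: ChenQuantumLattice2024, §3.5.9 (9.e)–(9.g) pp. 37–38] -/
theorem processedOf_sub (K : ZMod S.N → ZMod S.N → ℂ) (ψ φ : Ket (S.n + 1) S.N) :
    S.processedOf K (ψ - φ) = S.processedOf K ψ - S.processedOf K φ := by
  funext z
  simp only [processedOf, Pi.sub_apply, mul_sub, Finset.sum_sub_distrib]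

/-- Column form: on the fibre `z[1..n] = u′` the processing is `K` acting on the column `y ↦ ψ(y, u′)`, so
`Σ_{u₀} |processedOf K ψ (u₀,u′)|² = ⟨col|KᴴK|col⟩`. [cite: ChenQuantumLattice2024, §3.5.9 (9.e)–(9.g) pp. 37–38] -/
theorem sum_norm_sq_processedOf_cons (K : Matrix (ZMod S.N) (ZMod S.N) ℂ) (ψ : Ket (S.n + 1) S.N)
    (u' : Fin S.n → ZMod S.N) :
    ∑ u₀, ‖S.processedOf K ψ (Fin.cons u₀ u')‖ ^ 2
      = (star (fun y => ψ (Fin.cons y u')) ⬝ᵥ ((star K * K) *ᵥ fun y => ψ (Fin.cons y u'))).re := by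
  have h1 : ∀ u₀, S.processedOf K ψ (Fin.cons u₀ u') = (K *ᵥ fun y => ψ (Fin.cons y u')) u₀ := by
    intro u₀
    simp only [processedOf, Fin.cons_zero, Fin.tail_cons, Matrix.mulVec, dotProduct]
  have key : star (fun y => ψ (Fin.cons y u')) ⬝ᵥ ((star K * K) *ᵥ fun y => ψ (Fin.cons y u'))
      = star (K *ᵥ fun y => ψ (Fin.cons y u')) ⬝ᵥ (K *ᵥ fun y => ψ (Fin.cons y u')) := by
    rw [← Matrix.mulVec_mulVec, dotProduct_mulVec, star_eq_conjTranspose, vecMul_conjTranspose, star_star]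
  simp_rw [h1]
  rw [key, star_dotProduct_self_re_eq_sum]

/-- **A complete family of Kraus kernels on coordinate 1 preserves the norm:** `Σ_a KₐᴴKₐ = 1` gives
`Σ_a ‖processedOf Kₐ ψ‖² = ‖ψ‖²`. [cite: NielsenChuang2010, §2.2.3 p. 84, §8.2.3 p. 360] -/
theorem sum_norm_sq_processedOf_family {α : Type*} [Fintype α] (K : α → Matrix (ZMod S.N) (ZMod S.N) ℂ)
    (hK : ∑ a, star (K a) * K a = 1) (ψ : Ket (S.n + 1) S.N) :
    ∑ a, ∑ z, ‖S.processedOf (K a) ψ z‖ ^ 2 = ∑ z, ‖ψ z‖ ^ 2 := by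
  calc ∑ a, ∑ z, ‖S.processedOf (K a) ψ z‖ ^ 2
      = ∑ a, ∑ u' : Fin S.n → ZMod S.N, ∑ u₀, ‖S.processedOf (K a) ψ (Fin.cons u₀ u')‖ ^ 2 := by
        refine Finset.sum_congr rfl fun a _ => ?_
        rw [S.sum_cons (fun z => ‖S.processedOf (K a) ψ z‖ ^ 2), Finset.sum_comm]
    _ = ∑ u' : Fin S.n → ZMod S.N, (star (fun y => ψ (Fin.cons y u'))
          ⬝ᵥ ((∑ a, star (K a) * K a) *ᵥ fun y => ψ (Fin.cons y u'))).re := by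
        rw [Finset.sum_comm]
        refine Finset.sum_congr rfl fun u' _ => ?_
        simp_rw [S.sum_norm_sq_processedOf_cons, Matrix.sum_mulVec, dotProduct_sum, Complex.re_sum]
    _ = ∑ z, ‖ψ z‖ ^ 2 := by
        rw [hK, S.sum_cons (fun z => ‖ψ z‖ ^ 2), Finset.sum_comm]
        refine Finset.sum_congr rfl fun u' _ => ?_
        rw [Matrix.one_mulVec, star_dotProduct_self_re_eq_sum]

/-- **An isometry on coordinate 1 preserves the norm:** `KᴴK = 1` gives `‖processedOf K ψ‖² = ‖ψ‖²`.
[cite: NielsenChuang2010, §2.2.3 p. 84] -/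
theorem sum_norm_sq_processedOf (K : Matrix (ZMod S.N) (ZMod S.N) ℂ) (hK : star K * K = 1)
    (ψ : Ket (S.n + 1) S.N) : ∑ z, ‖S.processedOf K ψ z‖ ^ 2 = ∑ z, ‖ψ z‖ ^ 2 := by
  have h := S.sum_norm_sq_processedOf_family (fun _ : Unit => K) (by simpa using hK) ψ
  simpa using h

/-- For an isometry `K` the branch occurs: `processed K ≠ 0`. [cite: ChenQuantumLattice2024, eq. (40) p. 36] -/
theorem processed_ne_zero_of_star_mul_self (h : S.Admissible) (K : Matrix (ZMod S.N) (ZMod S.N) ℂ)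
    (hK : star K * K = 1) : S.processed K ≠ 0 := by
  intro h0
  have hf := (S.processed_eq_zero_iff h K).1 h0
  apply S.headKet_ne_zero h
  have hmv : K *ᵥ h.cert.headKet = 0 := by
    rw [← hf]
    rfl
  calc h.cert.headKet = (star K * K) *ᵥ h.cert.headKet := by rw [hK, Matrix.one_mulVec]
    _ = 0 := by rw [← Matrix.mulVec_mulVec, hmv, Matrix.mulVec_zero]

/-- Relative closeness survives an isometry on coordinate 1 and the final `QFT` (both linear, both scale all
norms by the same factor). [cite: ChenQuantumLattice2024, Lemma 2.12 p. 12, §3.5.9 (9.e)–(9.h) pp. 37–38] -/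
theorem qft_processedOf_close (K : Matrix (ZMod S.N) (ZMod S.N) ℂ) (hK : star K * K = 1)
    (ψ φ : Ket (S.n + 1) S.N) {δ : ℝ} (hclose : ∑ z, ‖ψ z - φ z‖ ^ 2 ≤ δ ^ 2 * ∑ z, ‖φ z‖ ^ 2) :
    ∑ u, ‖qft (S.processedOf K ψ) u - qft (S.processedOf K φ) u‖ ^ 2
      ≤ δ ^ 2 * ∑ u, ‖qft (S.processedOf K φ) u‖ ^ 2 := by
  have h1 : ∀ u, qft (S.processedOf K ψ) u - qft (S.processedOf K φ) u
      = qft (S.processedOf K (ψ - φ)) u := by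
    intro u
    rw [S.processedOf_sub, qft_sub, Pi.sub_apply]
  simp_rw [h1]
  rw [qft_norm_sq_sum, qft_norm_sq_sum, S.sum_norm_sq_processedOf K hK, S.sum_norm_sq_processedOf K hK,
    mul_left_comm]
  refine mul_le_mul_of_nonneg_left ?_ (by positivity)
  simpa only [Pi.sub_apply] using hclose

/-- **Step 9 on an approximate input, every event.**  For every isometric processing `K` of coordinate 1
(`KᴴK = 1`: every coherent replacement of (9.e)–(9.g), and `K = 1`), every event `V ⊆ ℤ_N^{n+1}` of the
final measurement after `QFT_{ℤ_N^{n+1}}` (9.h), and every input `ψ` with `‖ψ − φ8.f‖ ≤ δ‖φ8.f‖`: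
`|Pr_ψ[V] − Pr_{φ8.f}[V]| ≤ 4δ`.
[cite: ChenQuantumLattice2024, Lemma 2.11 p. 12, §3.5.9 pp. 34–38, eq. (40) p. 36] -/
theorem born_event_robust (K : Matrix (ZMod S.N) (ZMod S.N) ℂ) (hK : star K * K = 1)
    (V : Finset (Fin (S.n + 1) → ZMod S.N)) (ψ : Ket (S.n + 1) S.N) {δ : ℝ} (hδ : 0 ≤ δ)
    (hclose : ∑ z, ‖ψ z - S.phi8f z‖ ^ 2 ≤ δ ^ 2 * ∑ z, ‖S.phi8f z‖ ^ 2) :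
    |basisProb V (qft (S.processedOf K ψ)) - basisProb V (qft (S.processed K))| ≤ 4 * δ := by
  rw [← S.processedOf_phi8f]
  exact abs_basisProb_sub_le V _ _ hδ (S.qft_processedOf_close K hK ψ S.phi8f hclose)

/-- `Pr_K[(41)]` of `ChenQuantumLWEStepNineVerdict` is the event `(41)` of the basis measurement of
`QFT (processed K)`. [cite: ChenQuantumLattice2024, eq. (41) p. 38] -/
theorem probEq41_eq_basisProb [DecidablePred S.eq41] (K : ZMod S.N → ZMod S.N → ℂ) :
    S.probEq41 K = basisProb (univ.filter S.eq41) (qft (S.processed K)) := rfl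

/-- **`Pr_ψ[(41)] ≤ 1/Q + 4δ` on an approximate input** (Lemma 3.8 claimed certainty): admissible shape with a
Bezout witness for `b*[2..n+1] mod Q`, isometric coordinate-1 processing `K`, any input `ψ` with
`‖ψ − φ8.f‖ ≤ δ‖φ8.f‖`. [cite: ChenQuantumLattice2024, Lemma 3.8 p. 21, eq. (41) p. 38, Lemma 2.11 p. 12] -/
theorem probEq41_robust (h : S.Admissible) [DecidablePred S.eq41]
    (w : Fin S.n → ℤ) (hw : ((∑ t, w t * S.bstar (Fin.succ t) : ℤ) : ZMod S.Q) = 1)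
    (K : Matrix (ZMod S.N) (ZMod S.N) ℂ) (hK : star K * K = 1)
    (ψ : Ket (S.n + 1) S.N) {δ : ℝ} (hδ : 0 ≤ δ)
    (hclose : ∑ z, ‖ψ z - S.phi8f z‖ ^ 2 ≤ δ ^ 2 * ∑ z, ‖S.phi8f z‖ ^ 2) :
    basisProb (univ.filter S.eq41) (qft (S.processedOf K ψ)) ≤ 1 / S.Q + 4 * δ := by
  have h1 := (abs_sub_le_iff.1 (S.born_event_robust K hK (univ.filter S.eq41) ψ hδ hclose)).1
  have h2 : basisProb (univ.filter S.eq41) (qft (S.processed K)) ≤ 1 / S.Q := by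
    rw [← S.probEq41_eq_basisProb]
    exact S.probEq41_le h w hw K (S.processed_ne_zero_of_star_mul_self h K hK)
  linarith

/-- **`Pr_ψ[(41)] ≤ 1/Q + 4δ`, Bezout hypothesis discharged by eq. (39)'s planted slots.**
[cite: ChenQuantumLattice2024, eq. (39) p. 36, eq. (41) p. 38, Lemma 2.11 p. 12] -/
theorem probEq41_robust_planted (h : S.Admissible) [DecidablePred S.eq41] (Pl : S.Planted)
    (K : Matrix (ZMod S.N) (ZMod S.N) ℂ) (hK : star K * K = 1)
    (ψ : Ket (S.n + 1) S.N) {δ : ℝ} (hδ : 0 ≤ δ)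
    (hclose : ∑ z, ‖ψ z - S.phi8f z‖ ^ 2 ≤ δ ^ 2 * ∑ z, ‖S.phi8f z‖ ^ 2) :
    basisProb (univ.filter S.eq41) (qft (S.processedOf K ψ)) ≤ 1 / S.Q + 4 * δ := by
  obtain ⟨w, hw⟩ := S.exists_bezout_planted h Pl
  exact S.probEq41_robust h w hw K hK ψ hδ hclose

/-- **The output law stays (`4δ`-)secret-independent.**  Two admissible instances with the same public
parameters have the same exact law (`born_weight_instance_indep`); so the actual run of the instance
`(b₂, v₂, c₂, w₂)` on a `δ`-accurate input has every event probability within `4δ` of the REFERENCE instance's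
exact law: Step 9's transcript carries at most `4δ` of instance information per event.
[cite: ChenQuantumLattice2024, §3.5.9 pp. 34–38, eq. (12) p. 17, Lemma 2.11 p. 12] -/
theorem born_event_robust_instance_indep (h : S.Admissible) {b₂ v₂ c₂ w₂ : Fin (S.n + 1) → ℤ}
    (h₂ : (S.withVectors b₂ v₂ c₂ w₂).Admissible) (K : Matrix (ZMod S.N) (ZMod S.N) ℂ)
    (hK : star K * K = 1) (V : Finset (Fin (S.n + 1) → ZMod S.N)) (ψ : Ket (S.n + 1) S.N) {δ : ℝ}
    (hδ : 0 ≤ δ)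
    (hclose : ∑ z, ‖ψ z - (S.withVectors b₂ v₂ c₂ w₂).phi8f z‖ ^ 2
      ≤ δ ^ 2 * ∑ z, ‖(S.withVectors b₂ v₂ c₂ w₂).phi8f z‖ ^ 2) :
    |basisProb V (qft ((S.withVectors b₂ v₂ c₂ w₂).processedOf K ψ)) - basisProb V (qft (S.processed K))|
      ≤ 4 * δ := by
  have h1 := (S.withVectors b₂ v₂ c₂ w₂).born_event_robust K hK V ψ hδ hclose
  have h3 : basisProb V (qft ((S.withVectors b₂ v₂ c₂ w₂).processed K)) = basisProb V (qft (S.processed K)) := by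
    unfold basisProb
    exact congrArg₂ (· / ·) (Finset.sum_congr rfl fun u _ => S.born_weight_instance_indep h h₂ K u)
      (Finset.sum_congr rfl fun u _ => S.born_weight_instance_indep h h₂ K u)
  calc |basisProb V (qft ((S.withVectors b₂ v₂ c₂ w₂).processedOf K ψ)) - basisProb V (qft (S.processed K))|
      = |basisProb V (qft ((S.withVectors b₂ v₂ c₂ w₂).processedOf K ψ))
          - basisProb V (qft ((S.withVectors b₂ v₂ c₂ w₂).processed K))| := by rw [h3]
    _ ≤ 4 * δ := h1

/-! ### 6. Step 9 under an instrument on coordinate 1, approximate input -/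

/-- **`Pr_{I,ψ}[(41)] ≤ 1/Q + 4δ` for every trace-preserving instrument on coordinate 1** (records `a ∈ α`,
Kraus kernels `Kₐ` with `Σ_a KₐᴴKₐ = 1`: Chen's (9.f) measurement with any record-dependent repair of (9.g)),
on any input `ψ` with `‖ψ − φ8.f‖ ≤ δ‖φ8.f‖`; the joint law of (record, outcome) is the basis law of the ket
`(a, u) ↦ QFT(processedOf Kₐ ψ)(u)`, and on `|φ8.f⟩` it is `probEq41I K ≤ 1/Q` (`ChenQuantumLWEStepNineInstrument`).
[cite: ChenQuantumLattice2024, §3.5.9 (9.e)–(9.h) pp. 37–38, eq. (41) p. 38, Lemma 2.11 p. 12;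
NielsenChuang2010, §8.2.3 p. 360] -/
theorem probEq41I_robust (h : S.Admissible) [DecidablePred S.eq41]
    (w : Fin S.n → ℤ) (hw : ((∑ t, w t * S.bstar (Fin.succ t) : ℤ) : ZMod S.Q) = 1)
    {α : Type*} [Fintype α] [DecidableEq α] (K : α → Matrix (ZMod S.N) (ZMod S.N) ℂ)
    (hK : ∑ a, star (K a) * K a = 1) (ψ : Ket (S.n + 1) S.N) {δ : ℝ} (hδ : 0 ≤ δ)
    (hclose : ∑ z, ‖ψ z - S.phi8f z‖ ^ 2 ≤ δ ^ 2 * ∑ z, ‖S.phi8f z‖ ^ 2) :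
    basisProb (univ.filter fun p : α × (Fin (S.n + 1) → ZMod S.N) => S.eq41 p.2)
        (fun p => qft (S.processedOf (K p.1) ψ) p.2) ≤ 1 / S.Q + 4 * δ := by
  set V := (univ.filter fun p : α × (Fin (S.n + 1) → ZMod S.N) => S.eq41 p.2) with hV
  have hlin : ∀ (φ : Ket (S.n + 1) S.N),
      ∑ p : α × (Fin (S.n + 1) → ZMod S.N), ‖qft (S.processedOf (K p.1) φ) p.2‖ ^ 2
        = ((S.N : ℕ) : ℝ) ^ (S.n + 1) * ∑ z, ‖φ z‖ ^ 2 := by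
    intro φ
    rw [Fintype.sum_prod_type]
    simp only []
    simp_rw [qft_norm_sq_sum]
    rw [← Finset.mul_sum, S.sum_norm_sq_processedOf_family K hK φ]
  have hclose' : ∑ p : α × (Fin (S.n + 1) → ZMod S.N),
      ‖qft (S.processedOf (K p.1) ψ) p.2 - qft (S.processedOf (K p.1) S.phi8f) p.2‖ ^ 2
        ≤ δ ^ 2 * ∑ p : α × (Fin (S.n + 1) → ZMod S.N), ‖qft (S.processedOf (K p.1) S.phi8f) p.2‖ ^ 2 := by
    have h1 : ∀ p : α × (Fin (S.n + 1) → ZMod S.N),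
        qft (S.processedOf (K p.1) ψ) p.2 - qft (S.processedOf (K p.1) S.phi8f) p.2
          = qft (S.processedOf (K p.1) (ψ - S.phi8f)) p.2 := by
      intro p
      rw [S.processedOf_sub, qft_sub, Pi.sub_apply]
    simp_rw [h1]
    rw [hlin, hlin, mul_left_comm]
    refine mul_le_mul_of_nonneg_left ?_ (by positivity)
    simpa only [Pi.sub_apply] using hclose
  have hb := (abs_sub_le_iff.1 (abs_basisProb_sub_le V _ _ hδ hclose')).1
  have hexact : basisProb V (fun p : α × (Fin (S.n + 1) → ZMod S.N) => qft (S.processedOf (K p.1) S.phi8f) p.2)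
      = S.probEq41I (fun a => (K a : ZMod S.N → ZMod S.N → ℂ)) := by
    unfold basisProb probEq41I totalI weightI
    rw [hV, Finset.sum_filter, Fintype.sum_prod_type, Fintype.sum_prod_type]
    simp_rw [← Finset.sum_filter]
    rfl
  have hle : S.probEq41I (fun a => (K a : ZMod S.N → ZMod S.N → ℂ)) ≤ 1 / S.Q := S.probEq41I_le _ h w hw
  linarith

/-! ### 7. Step 8 on an approximate input -/

/-- **The fifth operation still reads `v′₀/D mod Dp₁`, with probability `≥ 1 − 4δ`,** on any pre-measurement
ket `χ` with `‖χ − φ7.d‖ ≤ δ‖φ7.d‖` (on `|φ7.d⟩` itself the read-out is sure, `fifthOp_phi7d`): the positive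
half of Lemma 3.13 survives the approximation. [cite: ChenQuantumLattice2024, Lemma 3.13 p. 32, Claim 3.14
p. 33, §3.5.8 p. 34, Lemma 2.11 p. 12] -/
theorem fifthOp_readout_robust (h : S.Admissible) (χ : Ket (S.n + 1) S.M) {δ : ℝ} (hδ : 0 ≤ δ)
    (hclose : ∑ w, ‖χ w - S.phi7d w‖ ^ 2 ≤ δ ^ 2 * ∑ w, ‖S.phi7d w‖ ^ 2) :
    1 - 4 * δ ≤ basisProb (univ.filter fun w => S.read8 w = S.read8Value) χ := by
  have h1 := (abs_sub_le_iff.1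
    (abs_basisProb_sub_le (univ.filter fun w => S.read8 w = S.read8Value) χ S.phi7d hδ hclose)).2
  have hpos : 0 < ∑ w, ‖S.phi7d w‖ ^ 2 := by
    rw [← star_dotProduct_self_re_eq_sum]
    exact star_dotProduct_self_re_pos (S.phi7d_ne_zero h)
  have h2 : basisProb (univ.filter fun w => S.read8 w = S.read8Value) S.phi7d = 1 := by
    unfold basisProb
    rw [Finset.sum_filter]
    have h3 : ∀ w, (if S.read8 w = S.read8Value then ‖S.phi7d w‖ ^ 2 else 0) = ‖S.phi7d w‖ ^ 2 := by
      intro w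
      by_cases hw : S.phi7d w = 0
      · simp [hw]
      · rw [if_pos (S.read8_eq_of_phi7d_ne_zero h hw)]
    simp_rw [h3]
    exact div_self hpos.ne'
  linarith

/-- **The Step-8 obstruction survives the approximation.**  Let `actual (b₂, v₂)` be ANY assignment of
pre-measurement kets to the admissible instances, each with `‖actual − φ7.d(b₂,v₂)‖ ≤ δ‖φ7.d(b₂,v₂)‖` (what
Steps 1–8 deliver by Lemmas 2.15, 3.10, 3.20, 3.29).  If `4(ε + 4δ)P² < 1` (`ε, δ ≥ 0`, `n ≥ 1`) then NO general
measurement of the Step-8 register returns, on the actual ket of every instance, that instance's Step-9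
datum `v′₀ mod D²P` `ε`-almost surely — by `step9Needs_not_almostSurely_measurable` at tolerance `ε + 4δ`
and `POVM.AlmostCertain.of_close`.  [cite: ChenQuantumLattice2024, Lemma 3.13 p. 32, §3.5.9 p. 37,
Lemma 2.11 p. 12, Cond. C.3 p. 18] -/
theorem step9Needs_not_almostSurely_measurable_robust (h : S.Admissible) (hn : 0 < S.n) {ε δ : ℝ}
    (hε : 0 ≤ ε) (hδ : 0 ≤ δ) (hεδ : 4 * (ε + 4 * δ) * ((S.P : ℕ) : ℝ) ^ 2 < 1)
    (E : POVM (Fin (S.n + 1) → ZMod S.M) (ZMod S.N))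
    (actual : (Fin (S.n + 1) → ℤ) → (Fin (S.n + 1) → ℤ) → Ket (S.n + 1) S.M)
    (hactual : ∀ b₂ v₂ : Fin (S.n + 1) → ℤ, (S.inst b₂ v₂).Admissible →
      ∑ w, ‖actual b₂ v₂ w - (S.inst b₂ v₂).phi7d w‖ ^ 2 ≤ δ ^ 2 * ∑ w, ‖(S.inst b₂ v₂).phi7d w‖ ^ 2) :
    ¬ ∀ b₂ v₂ : Fin (S.n + 1) → ℤ, (S.inst b₂ v₂).Admissible →
        E.AlmostCertain ε (actual b₂ v₂) (S.inst b₂ v₂).step9Needs := by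
  intro H
  refine S.step9Needs_not_almostSurely_measurable h hn hεδ E fun b₂ v₂ hI => ?_
  exact (H b₂ v₂ hI).of_close hε hδ (dotProduct_close_of_sum_close (hactual b₂ v₂ hI))

/-- **Summary: the quantum subroutine's verdicts for the algorithm as specified (approximate front end).**
For an admissible shape with eq. (39)'s planted slots and ANY `δ ≥ 0`:
(1) Step 9: for every isometric coordinate-1 processing and every input within relative distance `δ` of
`|φ8.f⟩`, `Pr[(41)] ≤ 1/Q + 4δ` and every event of the final measurement is within `4δ` of its
instance-independent exact probability; (2) Step 8: on every ket within `δ` of `|φ7.d⟩` the fifth operation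
reads `v′₀/D mod Dp₁` with probability `≥ 1 − 4δ`, and (`n ≥ 1`, `ε ≥ 0`, `4(ε+4δ)P² < 1`) no general
measurement reads `v′₀ mod D²P` `ε`-almost surely off any `δ`-accurate family of actual states.
[cite: ChenQuantumLattice2024, Lemma 2.11 p. 12, §3.5.8 pp. 32–34, §3.5.9 pp. 34–38, eq. (39) p. 36,
eq. (41) p. 38, notes pp. 1, 37] -/
theorem quantum_subroutine_verdict_robust (h : S.Admissible) [DecidablePred S.eq41] (Pl : S.Planted)
    {δ : ℝ} (hδ : 0 ≤ δ) :
    (∀ (K : Matrix (ZMod S.N) (ZMod S.N) ℂ), star K * K = 1 → ∀ ψ : Ket (S.n + 1) S.N,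
        ∑ z, ‖ψ z - S.phi8f z‖ ^ 2 ≤ δ ^ 2 * ∑ z, ‖S.phi8f z‖ ^ 2 →
        basisProb (univ.filter S.eq41) (qft (S.processedOf K ψ)) ≤ 1 / S.Q + 4 * δ ∧
        ∀ V, |basisProb V (qft (S.processedOf K ψ)) - basisProb V (qft (S.processed K))| ≤ 4 * δ) ∧
    (∀ χ : Ket (S.n + 1) S.M, ∑ w, ‖χ w - S.phi7d w‖ ^ 2 ≤ δ ^ 2 * ∑ w, ‖S.phi7d w‖ ^ 2 →
        1 - 4 * δ ≤ basisProb (univ.filter fun w => S.read8 w = S.read8Value) χ) ∧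
    (0 < S.n → ∀ {ε : ℝ}, 0 ≤ ε → 4 * (ε + 4 * δ) * ((S.P : ℕ) : ℝ) ^ 2 < 1 →
      ∀ (E : POVM (Fin (S.n + 1) → ZMod S.M) (ZMod S.N))
        (actual : (Fin (S.n + 1) → ℤ) → (Fin (S.n + 1) → ℤ) → Ket (S.n + 1) S.M),
        (∀ b₂ v₂ : Fin (S.n + 1) → ℤ, (S.inst b₂ v₂).Admissible →
          ∑ w, ‖actual b₂ v₂ w - (S.inst b₂ v₂).phi7d w‖ ^ 2
            ≤ δ ^ 2 * ∑ w, ‖(S.inst b₂ v₂).phi7d w‖ ^ 2) →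
        ¬ ∀ b₂ v₂ : Fin (S.n + 1) → ℤ, (S.inst b₂ v₂).Admissible →
            E.AlmostCertain ε (actual b₂ v₂) (S.inst b₂ v₂).step9Needs) :=
  ⟨fun K hK ψ hc => ⟨S.probEq41_robust_planted h Pl K hK ψ hδ hc, fun V => S.born_event_robust K hK V ψ hδ hc⟩,
    fun χ hc => S.fifthOp_readout_robust h χ hδ hc,
    fun hn _ hε hεδ E actual hact => S.step9Needs_not_almostSurely_measurable_robust h hn hε hδ hεδ E actual hact⟩

end Shape

end Literature.Computability.Cryptography.Chen2024
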